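import Summits.RiemannHypothesis.RiemannHypothesis.Theses.WeilWindowFlow
import HarnessLib

/-!
# `FiniteDiniOffCountable` from `WindowLipschitz` (bridge for line `Sketch` of crux `GronwallLeakage`)

Line `Sketch` of the crux `GronwallLeakage` (route WeilWindowFlow, item stmt-RiemannHypothesis-1037)
cuts the crux as `StrictPos ∧ LogAC` and obtains `LogAC` from continuity + antitonicity of the window
bottom `ε = weilGroundEnergy` and the registered regularity stub `stub_finiteDiniOffCountable`:

> off a countable set `s` of windows, every `a > 0`, `a ∉ s`, admits `M` with
> `-(M h) ≤ ε (a + h) - ε a` for all small `h > 0` (finite lower-right Dini derivate).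

This file records, sorry-free, that the sibling crux `WindowLipschitz` (item
stmt-RiemannHypothesis-1039: `ε` is one-sidedly Lipschitz on every compact window range
`[b₀, A] ⊂ (0, ∞)`) implies that stub, with `s = ∅` and `M = L(a, a + 1)`:
`finiteDiniOffCountable_of_windowLipschitz`. So any proof of crux 1039 closes the regularity stub of
line `Sketch` by a one-line application.

Not here: the stub itself (unconditional; open), `DiniLeakage → stub` (false as an implication of
statements: `DiniLeakage`'s `∃ h < δ` form bounds only one Dini derivate from one side).
Axioms ⊆ {propext, Classical.choice, Quot.sound}.
-/

-- `Summit.RiemannHypothesis.RiemannHypothesis.…` repeats a namespace component by design (D-0017 layout).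
set_option linter.dupNamespace false

noncomputable section

open MeasureTheory Set Filter
open scoped Topology

namespace Summit.RiemannHypothesis.RiemannHypothesis.Theorems.WeilWindowFlowGronwallLeakage

open Literature.NumberTheory.LFunctions
open Summit.RiemannHypothesis.RiemannHypothesis.Theses.WeilWindowFlow (WindowLipschitz)

/-- **Bridge `WindowLipschitz → FiniteDiniOffCountable`.** If the window bottom `ε` is one-sidedly
Lipschitz on every compact window range `[b₀, A] ⊂ (0, ∞)` (crux `WindowLipschitz`, item 1039), then at
EVERY window `a > 0` (exceptional set `s = ∅`) the lower-right Dini derivate of `ε` is finite: with `L`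
the constant on `[a, a + 1]`, `-(L h) ≤ ε (a + h) - ε a` for `0 < h < 1`. [folklore] -/
theorem finiteDiniOffCountable_of_windowLipschitz : WindowLipschitz → ∃ s : Set ℝ, s.Countable ∧ ∀ a : ℝ, 0 < a → a ∉ s → ∃ M : ℝ, ∀ᶠ h in 𝓝[>] (0 : ℝ), -(M * h) ≤ weilGroundEnergy (a + h) - weilGroundEnergy a := by
  intro hW
  refine ⟨∅, countable_empty, fun a ha _ ↦ ?_⟩
  obtain ⟨L, hL⟩ := hW a (a + 1) ha (by linarith)
  refine ⟨L, ?_⟩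
  have hmem : Ioo (0 : ℝ) 1 ∈ 𝓝[>] (0 : ℝ) := Ioo_mem_nhdsGT one_pos
  filter_upwards [hmem] with h hh
  have key := hL a (a + h) le_rfl (by linarith [hh.1]) (by linarith [hh.2])
  have hsub : a + h - a = h := by ring
  rw [hsub] at key
  linarith

end Summit.RiemannHypothesis.RiemannHypothesis.Theorems.WeilWindowFlowGronwallLeakage

end
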